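import Summits.RiemannHypothesis.RiemannHypothesis.Theorems.Splittings.ScrewIndexTransferKreinCore
import Summits.RiemannHypothesis.RiemannHypothesis.Theorems.IntegerScrewFozIndexBound
import HarnessLib

/-!
# Screw index transfer via Kreĭn definitizability — add-on: the QUANTITATIVE count
# (`≤ 4 · deg Q` distinct off-line zeros; `≤ 4 (K + 1)` from a uniform negative-index bound `K`; conversely `K ≤ 2 N`)

rh-split-screw-bridge g5 (pub cell), optional file 6 after `ScrewIndexTransferKreinCore` (card `SPLIT-screw-bridge.md` §10-U⁗⁗).
`offLine_root` re-runs the assembly of pieces (A)–(E) (= `core_of_pieces` stopped before (F)) to expose the root property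
`Q(i w₀) = 0 ∨ Q(conj(i w₀)) = 0` at every zero `½ + w₀` of `ξ` with `Re w₀ > 0`; `offLine_ncard_le` is the quantitative (F):
the distinct nontrivial zeros off the line number at most `4 · natDegree Q`; with the landed `exists_exactIndex` (p505922) and the
degree clause `natDegree Q ≤ k` of the named fact, `offLine_ncard_le_of_indexBounded (h1 : Stewart1972_thm_3_1) (K)
(hK : ∀ n, #{negative eigenvalues of screwMatrix n} ≤ K) : #{distinct off-line zeros} ≤ 4 (K + 1)`.
Conversely `negIndex_le_two_mul_ncard` is the landed R1 `IntegerScrew.FozIndexBound.fozIndexBound` (p469353) with its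
constant exposed: given finitely many off-line zeros, every screw node matrix has at most `2 · #{distinct off-line zeros}`
negative eigenvalues (unconditional).  Together (SANDWICH, modulo the fact for the second inequality): with `N` the number
of distinct off-line zeros and `K⋆ = sup_n #{negative eigenvalues of screwMatrix n}` (both finite iff FOZ iff ETAIL, by
Part X + `etail_iff_foz`), `K⋆ ≤ 2 N` and `N ≤ 4 (K⋆ + 1)`.  The method is blind to multiplicity on both sides (the
logarithmic derivative of `ξ` has simple poles; the explicit formula's off-line term is one rank-≤-2 difference per zero).

HONEST LABEL.  A bound on the number of DISTINCT off-line zeros in terms of the negative index of the screw node matrices is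
a relation between two RH-consequences (both sides are trivial under RH and neither is asserted); it is conditional on the named
printed fact `Stewart1972_thm_3_1` exactly like `indexTransferKrein`.  Nothing here bears on the truth of RH.
-/

noncomputable section

set_option linter.dupNamespace false

namespace Summit.RiemannHypothesis.RiemannHypothesis.Theorems.Splittings.ScrewKreinCore

open Finset Matrix Complex MeasureTheory Set Filter Topology
open Literature.NumberTheory.LFunctions
open Literature.Analysis.OperatorTheory
open Summit.RiemannHypothesis.RiemannHypothesis.Theses.RuelleBand
open Summit.RiemannHypothesis.RiemannHypothesis.Theorems.IntegerScrew

/-! ## The root property of the off-line zeros (assembly of (A)–(E), i.e. `core_of_pieces` stopped before (F)) -/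

/-- For `Q` with `KreinPos Q`: every zero `½ + w₀` of `ξ` with `Re w₀ > 0` has `Q(i w₀) = 0` or
`Q(conj(i w₀)) = 0` (pieces (A)–(E), exactly as in `core_of_pieces`). -/
theorem offLine_root (Q : Polynomial ℂ) (hpos : KreinPos Q) :
    ∀ w₀ : ℂ, 0 < w₀.re → riemannXi (1 / 2 + w₀) = 0 →
      Q.eval (I * w₀) = 0 ∨ Q.eval ((starRingEnd ℂ) (I * w₀)) = 0 := by
  intro w₀ hw₀ hξ
  obtain ⟨φ, hφ, h1φ, h2φ⟩ := pieceE_holds w₀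
  obtain ⟨hcont, C, hCb⟩ := pieceA_holds Q φ hpos hφ
  obtain ⟨hGan, H, hH, hid⟩ := pieceB_holds Q φ hφ ⟨hcont, C, hCb⟩
  obtain ⟨hcan, hsym⟩ := pieceD_holds Q φ hφ
  have hid' : ∀ w : ℂ, 1 < w.re → lap (transl Q φ) w = bilap (corr Q φ) w * lapF w + H w := by
    intro w hw; rw [hid w hw, pieceBp hw]
  have hc0 := pieceC_holds (lap (transl Q φ)) H (bilap (corr Q φ)) hGan hH hcan hid' w₀ hw₀ hξ
  rw [hsym w₀] at hc0
  rcases mul_eq_zero.mp hc0 with h | h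
  · rcases mul_eq_zero.mp h with h | h
    · rcases mul_eq_zero.mp h with h | h
      · exact Or.inl h
      · exact Or.inr ((map_eq_zero (starRingEnd ℂ)).mp h)
    · exact absurd h h1φ
  · exact absurd ((map_eq_zero (starRingEnd ℂ)).mp h) h2φ

/-! ## Quantitative (F): at most `4 · deg Q` distinct off-line zeros -/

/-- **Quantitative count.** Under the root property, the DISTINCT nontrivial zeros of `ζ` off the critical line
number at most `4 · natDegree Q`: those with `Re s > ½` are `½ − i·l` or `½ − i·conj l` for a root `l` of `Q`
(`≤ 2 · #roots`), and `s ↦ 1 − s` accounts for `Re s < ½`. -/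
theorem offLine_ncard_le (Q : Polynomial ℂ) (hQ0 : Q ≠ 0)
    (hz : ∀ w₀ : ℂ, 0 < w₀.re → riemannXi (1 / 2 + w₀) = 0 →
      Q.eval (I * w₀) = 0 ∨ Q.eval ((starRingEnd ℂ) (I * w₀)) = 0) :
    {s : ℂ | riemannZeta s = 0 ∧ 0 < s.re ∧ s.re < 1 ∧ s.re ≠ 1 / 2}.ncard ≤ 4 * Q.natDegree := by
  classical
  set R : Finset ℂ := Q.roots.toFinset with hR
  set g₁ : ℂ → ℂ := fun l => 1 / 2 + -I * l with hg₁
  set g₂ : ℂ → ℂ := fun l => 1 / 2 + -I * (starRingEnd ℂ) l with hg₂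
  set Sp : Finset ℂ := R.image g₁ ∪ R.image g₂ with hSp_def
  set T : Finset ℂ := Sp ∪ Sp.image (fun z => 1 - z) with hT_def
  have hmemR : ∀ l : ℂ, Q.eval l = 0 → l ∈ R := by
    intro l hl
    simp only [hR, Multiset.mem_toFinset, Polynomial.mem_roots hQ0, Polynomial.IsRoot.def, hl]
  have key : ∀ s : ℂ, riemannZeta s = 0 → 0 < s.re → s.re < 1 → 1 / 2 < s.re → s ∈ Sp := by
    intro s h0 h1 h2 h3
    have hξ : riemannXi (1 / 2 + (s - 1 / 2)) = 0 := by
      rw [show (1 / 2 : ℂ) + (s - 1 / 2) = s by ring]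
      exact (riemannXi_eq_zero_iff_holds s).2 ⟨h0, h1, h2⟩
    have hw : 0 < (s - 1 / 2).re := by simp; linarith
    have hII : -I * (I * (s - 1 / 2)) = s - 1 / 2 := by
      rw [← mul_assoc, neg_mul, I_mul_I, neg_neg, one_mul]
    rw [hSp_def, Finset.mem_union, Finset.mem_image, Finset.mem_image]
    rcases hz _ hw hξ with h | h
    · refine Or.inl ⟨I * (s - 1 / 2), hmemR _ h, ?_⟩
      simp only [hg₁, hII]; ring
    · refine Or.inr ⟨(starRingEnd ℂ) (I * (s - 1 / 2)), hmemR _ h, ?_⟩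
      simp only [hg₂, Complex.conj_conj, hII]; ring
  have hsub : {s : ℂ | riemannZeta s = 0 ∧ 0 < s.re ∧ s.re < 1 ∧ s.re ≠ 1 / 2} ⊆ (T : Set ℂ) := by
    rintro s ⟨h0, h1, h2, h3⟩
    rw [Finset.mem_coe, hT_def, Finset.mem_union]
    rcases lt_or_gt_of_ne h3 with hlt | hgt
    · right
      have hξ : riemannXi (1 - s) = 0 := by
        rw [riemannXi_one_sub]; exact (riemannXi_eq_zero_iff_holds s).2 ⟨h0, h1, h2⟩
      obtain ⟨h0', h1', h2'⟩ := (riemannXi_eq_zero_iff_holds (1 - s)).1 hξ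
      refine Finset.mem_image.mpr ⟨1 - s, key (1 - s) h0' h1' h2' ?_, by ring⟩
      simp; linarith
    · exact Or.inl (key s h0 h1 h2 hgt)
  have hRcard : R.card ≤ Q.natDegree :=
    (Multiset.toFinset_card_le Q.roots).trans (Polynomial.card_roots' Q)
  have hSp : Sp.card ≤ 2 * Q.natDegree :=
    calc Sp.card ≤ (R.image g₁).card + (R.image g₂).card := Finset.card_union_le _ _
      _ ≤ R.card + R.card := Nat.add_le_add Finset.card_image_le Finset.card_image_le
      _ ≤ 2 * Q.natDegree := by omega
  calc {s : ℂ | riemannZeta s = 0 ∧ 0 < s.re ∧ s.re < 1 ∧ s.re ≠ 1 / 2}.ncard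
      ≤ (T : Set ℂ).ncard := Set.ncard_le_ncard hsub T.finite_toSet
    _ = T.card := Set.ncard_coe_finset T
    _ ≤ Sp.card + (Sp.image fun z => 1 - z).card := Finset.card_union_le _ _
    _ ≤ Sp.card + Sp.card := Nat.add_le_add le_rfl Finset.card_image_le
    _ ≤ 4 * Q.natDegree := by omega

/-- **Quantitative Theorem B (modulo the named printed fact).** If every screw node matrix has at most `K` negative
eigenvalues, then `ζ` has at most `4 (K + 1)` DISTINCT nontrivial zeros off the critical line (the `+1` is the
mean-zero dimension of the node reduction, tree `exists_exactIndex`; `natDegree Q ≤ k ≤ K + 1` is the fact's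
degree clause).  Nothing here bears on the truth of RH. -/
theorem offLine_ncard_le_of_indexBounded (h1 : Stewart1972_thm_3_1) (K : ℕ)
    (hK : ∀ n : ℕ,
      (Finset.univ.filter fun i => (screwMatrix_isHermitian n).eigenvalues i < 0).card ≤ K) :
    {s : ℂ | riemannZeta s = 0 ∧ 0 < s.re ∧ s.re < 1 ∧ s.re ≠ 1 / 2}.ncard ≤ 4 * (K + 1) := by
  obtain ⟨k, hkK, hle, hex⟩ := ScrewIndexTransferKrein.exists_exactIndex K hK
  obtain ⟨Q, hQ0, hdeg, hpos⟩ :=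
    h1 (fun u : ℝ => ((-zetaScrew u : ℝ) : ℂ)) ScrewIndexTransferKrein.negScrewC_symm k continuous_fC hle hex
  calc {s : ℂ | riemannZeta s = 0 ∧ 0 < s.re ∧ s.re < 1 ∧ s.re ≠ 1 / 2}.ncard
      ≤ 4 * Q.natDegree := offLine_ncard_le Q hQ0 (offLine_root Q hpos)
    _ ≤ 4 * (K + 1) := Nat.mul_le_mul_left 4 (hdeg.trans hkK)

/-- In particular (K = 0 is NOT needed for this): positive SEMI-definiteness of all screw node matrices already
confines the distinct off-line zeros to at most four points.  (The screw criterion proper, `∀ M, 0 < screwPivot M`,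
gives RH outright by the tree's screw equivalence; this corollary is only the `K = 0` row of the count.) -/
theorem offLine_ncard_le_four_of_psd (h1 : Stewart1972_thm_3_1)
    (h0 : ∀ n : ℕ, (Finset.univ.filter fun i => (screwMatrix_isHermitian n).eigenvalues i < 0).card = 0) :
    {s : ℂ | riemannZeta s = 0 ∧ 0 < s.re ∧ s.re < 1 ∧ s.re ≠ 1 / 2}.ncard ≤ 4 :=
  offLine_ncard_le_of_indexBounded h1 0 fun n => (h0 n).le

/-! ## The converse direction, quantitatively: the tree's `fozIndexBound` with its constant exposed -/

open Summit.RiemannHypothesis.RiemannHypothesis.Theorems.IntegerScrew.FozIndexBound in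
/-- **R1 with its constant** (the landed `IntegerScrew.FozIndexBound.fozIndexBound`, p469353, whose proof takes
`K = 2 · #F` but whose statement hides it): given finitely many off-line zeros, EVERY screw node matrix has at most
`2 · #{distinct off-line zeros}` negative eigenvalues — each distinct off-line zero contributes one difference of two
products of real linear forms to the explicit formula, the on-line part being a non-negative form.  Unconditional
(no printed fact); the finiteness hypothesis is needed only so that `Set.ncard` is the honest count. -/
theorem negIndex_le_two_mul_ncard (hfoz : CofiniteCriticalLine) (n : ℕ) :
    (Finset.univ.filter fun i => (screwMatrix_isHermitian n).eigenvalues i < 0).card ≤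
      2 * {s : ℂ | riemannZeta s = 0 ∧ 0 < s.re ∧ s.re < 1 ∧ s.re ≠ 1 / 2}.ncard := by
  classical
  have hfin : (Subtype.val ⁻¹'
      {s : ℂ | riemannZeta s = 0 ∧ 0 < s.re ∧ s.re < 1 ∧ s.re ≠ 1 / 2} :
        Set ZetaZeros.riemannZetaNontrivialZeros).Finite :=
    Set.Finite.preimage Subtype.val_injective.injOn hfoz
  set F : Finset ZetaZeros.riemannZetaNontrivialZeros := hfin.toFinset with hFdef
  have hF : ∀ ρ : ZetaZeros.riemannZetaNontrivialZeros, ρ ∉ F → (ρ : ℂ).re = 1 / 2 := by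
    intro ρ hρ
    by_contra hne
    apply hρ
    rw [hFdef, Set.Finite.mem_toFinset]
    obtain ⟨hz, h0, h1⟩ := ZetaZeros.riemannZetaNontrivialZeros.mem_iff'.1 ρ.2
    exact ⟨hz, h0, h1, hne⟩
  have hcard : F.card = {s : ℂ | riemannZeta s = 0 ∧ 0 < s.re ∧ s.re < 1 ∧ s.re ≠ 1 / 2}.ncard := by
    rw [hFdef, ← Set.ncard_eq_toFinset_card _ hfin]
    refine Set.ncard_preimage_of_injective_subset_range Subtype.val_injective ?_
    rintro s ⟨hz, h0, h1, -⟩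
    exact ⟨⟨s, ZetaZeros.riemannZetaNontrivialZeros.mem_iff'.2 ⟨hz, h0, h1⟩⟩, rfl⟩
  rw [← hcard]
  -- from here on: the landed proof of `fozIndexBound`, verbatim
  let e : Fin F.card ≃ {ρ // ρ ∈ F} := F.equivFin.symm
  let L₁ : Fin F.card → ((Fin n → ℝ) →ₗ[ℝ] ℝ) := fun j => ell₁ n ((e j : ZetaZeros.riemannZetaNontrivialZeros) : ℂ)
  let L₂ : Fin F.card → ((Fin n → ℝ) →ₗ[ℝ] ℝ) := fun j => ell₂ n ((e j : ZetaZeros.riemannZetaNontrivialZeros) : ℂ)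
  let L₃ : Fin F.card → ((Fin n → ℝ) →ₗ[ℝ] ℝ) := fun j => ell₃ n ((e j : ZetaZeros.riemannZetaNontrivialZeros) : ℂ)
  let L₄ : Fin F.card → ((Fin n → ℝ) →ₗ[ℝ] ℝ) := fun j => ell₄ n ((e j : ZetaZeros.riemannZetaNontrivialZeros) : ℂ)
  have hoff : ∀ x : Fin n → ℝ, ∑ j, (L₁ j x * L₃ j x - L₂ j x * L₄ j x) =
      ∑ ρ ∈ F, (zeroTerm n x (ρ : ℂ)).re := by
    intro x
    simp only [L₁, L₂, L₃, L₄, ← re_zeroTerm_eq_ell]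
    rw [Equiv.sum_comp e (fun ρ : {ρ // ρ ∈ F} =>
      (zeroTerm n x ((ρ : ZetaZeros.riemannZetaNontrivialZeros) : ℂ)).re)]
    exact Finset.sum_coe_sort F
      (fun ρ : ZetaZeros.riemannZetaNontrivialZeros => (zeroTerm n x (ρ : ℂ)).re)
  apply card_eigenvalues_neg_le_of_subspace_bound (screwMatrix_isHermitian n)
  intro N hN
  refine screwMatrix_finrank_negDef_le
    (P := fun x => x ⬝ᵥ (screwMatrix n *ᵥ x) - ∑ j, (L₁ j x * L₃ j x - L₂ j x * L₄ j x))
    ?_ L₁ L₂ L₃ L₄ (fun x => by ring) N hN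
  intro x
  have := sum_re_zeroTerm_le_form F hF n x
  rw [star_trivial] at this
  rw [hoff]
  linarith

end Summit.RiemannHypothesis.RiemannHypothesis.Theorems.Splittings.ScrewKreinCore

end
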